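import Summits.RiemannHypothesis.RiemannHypothesis.Theses.RuelleBand
import Summits.RiemannHypothesis.RiemannHypothesis.Theorems.RuelleBandAsymptoticCriticalLineSplit
import Literature.NumberTheory.LFunctions.ZeroDensityIngham
import Literature.NumberTheory.LFunctions.LindelofBacklundNecessity

/-!
# `AsymptoticCriticalLine` (crux stmt-RiemannHypothesis-2063): the interior half alone gives
# `N(σ, T) ≪ T^ε` for every `σ > 1/2` (hence the Density Hypothesis), unconditionally

Support file of the line `interior-edge-split` (lead prover-line-stmt-RiemannHypothesis-2063-0).
CALIBRATION of the line's stub 1 ("no right-interior band": every `σ₀ ∈ (1/2, 1)` has a vertical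
neighbourhood `|Re s − σ₀| < ε` with finitely many zeros of `ζ`), with NO analytic hypothesis: for every
`σ > 1/2` and `ε > 0`, `N(σ, T) = O(T^ε)` (`countRe_isBigO_rpow_of_noRightInteriorBand`), and in
particular the DENSITY HYPOTHESIS `N(σ, T) ≪ T^{2(1−σ)+ε}` (`densityHypothesis_of_noRightInteriorBand`).
Proof: for `0 < η < 1/2` the zeros with `σ ≤ Re ρ ≤ 1 − η` have bounded height (compactness,
`exists_im_le_of_noRightInteriorBand`), so `N(σ, T) ≤ N(σ, T₀) + N(1 − η, T)`
(`zetaZeroCountRe_le_add`), and Ingham's density theorem (PROVED in tree, `zeroDensity_ingham_holds`)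
gives `N(1 − η, T) ≪ T^{3η/(1+η) + ε/2} ≤ T^{ε}` for `η ≤ ε/6`.  So stub 1 sits above the density
hypothesis as well as above Lindelöf (`RuelleBandAsymptoticCriticalLineInteriorLindelof.lean`, which
needs a Richert bound); both classical zero-STATISTICS conjectures follow from this zero-LOCATION half of
the crux, and neither is known to imply it (barrier `LindelofBacklund`).
-/

noncomputable section

namespace Summit.RiemannHypothesis.RiemannHypothesis.Theorems.AsymptoticCriticalLine.InteriorEdgeSplit

open Complex Filter Topology Asymptotics Set
open Literature.NumberTheory.LFunctions


/-! ## Counting: a box inside a union of two boxes -/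

/-- If `zetaZeroBox σ T ⊆ zetaZeroBox σ₁ T₁ ∪ zetaZeroBox σ₂ T₂` then
`N(σ, T) ≤ N(σ₁, T₁) + N(σ₂, T₂)` (multiplicities are non-negative; `Finset.sum_union_inter`). -/
theorem zetaZeroCountRe_le_add {σ T σ₁ T₁ σ₂ T₂ : ℝ}
    (h : zetaZeroBox σ T ⊆ zetaZeroBox σ₁ T₁ ∪ zetaZeroBox σ₂ T₂) :
    (zetaZeroCountRe σ T : ℝ) ≤ zetaZeroCountRe σ₁ T₁ + zetaZeroCountRe σ₂ T₂ := by
  classical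
  have e0 := zetaZeroCountRe_eq_sum σ T
  have e1 := zetaZeroCountRe_eq_sum σ₁ T₁
  have e2 := zetaZeroCountRe_eq_sum σ₂ T₂
  set F := (zetaZeroBox_finite σ T).toFinset with hF
  set F₁ := (zetaZeroBox_finite σ₁ T₁).toFinset with hF₁
  set F₂ := (zetaZeroBox_finite σ₂ T₂).toFinset with hF₂
  have hsub : F ⊆ F₁ ∪ F₂ := by
    intro ρ hρ
    rw [Finset.mem_union, hF₁, hF₂, Set.Finite.mem_toFinset, Set.Finite.mem_toFinset]
    exact h ((Set.Finite.mem_toFinset _).1 hρ)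
  have hnn : ∀ ρ ∈ F₁ ∪ F₂, (0 : ℤ) ≤ riemannZetaZeroOrder ρ := by
    intro ρ hρ
    rw [Finset.mem_union, hF₁, hF₂, Set.Finite.mem_toFinset, Set.Finite.mem_toFinset] at hρ
    rcases hρ with hρ | hρ
    · exact riemannZetaZeroOrder_nonneg_of_mem_zetaZeroBox hρ
    · exact riemannZetaZeroOrder_nonneg_of_mem_zetaZeroBox hρ
  have hZ : ((zetaZeroCountRe σ T : ℕ) : ℤ) ≤ (zetaZeroCountRe σ₁ T₁ : ℕ) + (zetaZeroCountRe σ₂ T₂ : ℕ) := by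
    rw [e0, e1, e2]
    calc ∑ ρ ∈ F, riemannZetaZeroOrder ρ
        ≤ ∑ ρ ∈ F₁ ∪ F₂, riemannZetaZeroOrder ρ :=
          Finset.sum_le_sum_of_subset_of_nonneg hsub fun ρ hρ _ => hnn ρ hρ
      _ ≤ ∑ ρ ∈ F₁, riemannZetaZeroOrder ρ + ∑ ρ ∈ F₂, riemannZetaZeroOrder ρ := by
          rw [← Finset.sum_union_inter]
          have : 0 ≤ ∑ ρ ∈ F₁ ∩ F₂, riemannZetaZeroOrder ρ :=
            Finset.sum_nonneg fun ρ hρ => hnn ρ (Finset.mem_union_left _ (Finset.mem_inter.1 hρ).1)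
          linarith
  exact_mod_cast hZ

/-! ## The theorem -/

/-- **Stub 1 alone gives `N(σ, T) = O(T^ε)` for every `σ > 1/2`, `ε > 0` — unconditionally.** Under
"no right-interior band" (the line's stub `stub_noRightInteriorBand`, verbatim), for `η = min (ε/6) (1/4)`
the zeros with `σ ≤ Re ρ ≤ 1 − η` have height `≤ T₀` (`exists_im_le_of_noRightInteriorBand`), so
`N(σ, T) ≤ N(σ, T₀) + N(1 − η, T)` for `T ≥ T₀`, and Ingham's density theorem (`zeroDensity_ingham_holds`,
PROVED in tree) bounds `N(1 − η, T) ≪ T^{3η/(1+η) + ε/2} ≤ T^ε`. -/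
theorem countRe_isBigO_rpow_of_noRightInteriorBand
    (h1 : ∀ σ₀ : ℝ, 1 / 2 < σ₀ → σ₀ < 1 →
      ∃ ε : ℝ, 0 < ε ∧ {s : ℂ | riemannZeta s = 0 ∧ 0 < s.re ∧ s.re < 1 ∧ |s.re - σ₀| < ε}.Finite)
    {σ : ℝ} (hσ : 1 / 2 < σ) {ε : ℝ} (hε : 0 < ε) :
    (fun T : ℝ => (zetaZeroCountRe σ T : ℝ)) =O[atTop] fun T : ℝ => T ^ ε := by
  -- the parameter `η`
  set η : ℝ := min (ε / 6) (1 / 4) with hη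
  have hη0 : 0 < η := lt_min (by positivity) (by norm_num)
  have hη6 : η ≤ ε / 6 := min_le_left _ _
  have hη4 : η ≤ 1 / 4 := min_le_right _ _
  -- the interior slab `σ ≤ Re ρ ≤ 1 - η` has bounded height
  obtain ⟨T₀, hT₀⟩ := exists_im_le_of_noRightInteriorBand h1 (a := σ) (b := 1 - η) hσ (by linarith)
  -- Ingham at `1 - η`
  have hI := zeroDensity_ingham_holds (ε / 2) (by positivity) (1 - η) (by linarith) (by linarith)
  -- the exponent of Ingham's bound is `≤ ε`
  have hexp : 3 / (2 - (1 - η)) * (1 - (1 - η)) + ε / 2 ≤ ε := by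
    have h2 : 3 / (2 - (1 - η)) * (1 - (1 - η)) = 3 * η / (1 + η) := by
      rw [show (2 : ℝ) - (1 - η) = 1 + η by ring, show (1 : ℝ) - (1 - η) = η by ring]
      ring
    rw [h2]
    have h3 : 3 * η / (1 + η) ≤ 3 * η := by
      rw [div_le_iff₀ (by linarith)]
      nlinarith
    linarith
  -- `N(1 - η, T) = O(T^ε)`
  have hI' : (fun T : ℝ => (zetaZeroCountRe (1 - η) T : ℝ)) =O[atTop] fun T : ℝ => T ^ ε := by
    refine hI.trans (IsBigO.of_bound 1 ?_)
    filter_upwards [eventually_ge_atTop (1 : ℝ)] with T hT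
    rw [one_mul, Real.norm_of_nonneg (Real.rpow_nonneg (by linarith) _),
      Real.norm_of_nonneg (Real.rpow_nonneg (by linarith) _)]
    exact Real.rpow_le_rpow_of_exponent_le hT hexp
  -- the constant `N(σ, T₀)` is `O(T^ε)`
  have hC : (fun _ : ℝ => (zetaZeroCountRe σ T₀ : ℝ)) =O[atTop] fun T : ℝ => T ^ ε := by
    refine IsBigO.of_bound (zetaZeroCountRe σ T₀ : ℝ) ?_
    filter_upwards [eventually_ge_atTop (1 : ℝ)] with T hT
    rw [Real.norm_natCast, Real.norm_of_nonneg (Real.rpow_nonneg (by linarith) _)]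
    exact le_mul_of_one_le_right (Nat.cast_nonneg _) (Real.one_le_rpow hT hε.le)
  -- `N(σ, T) ≤ N(σ, T₀) + N(1 - η, T)` for `T ≥ T₀`
  have hle : ∀ᶠ T in atTop, ‖(zetaZeroCountRe σ T : ℝ)‖ ≤
      1 * ‖(zetaZeroCountRe σ T₀ : ℝ) + (zetaZeroCountRe (1 - η) T : ℝ)‖ := by
    filter_upwards [eventually_ge_atTop T₀] with T hT
    rw [one_mul, Real.norm_natCast, Real.norm_of_nonneg (by positivity)]
    refine zetaZeroCountRe_le_add ?_
    rintro ρ ⟨hz, hσρ, h1ρ, him0, himT⟩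
    by_cases hre : ρ.re ≤ 1 - η
    · exact Or.inl ⟨hz, hσρ, h1ρ, him0, hT₀ ρ hz hσρ hre⟩
    · exact Or.inr ⟨hz, (not_le.1 hre).le, h1ρ, him0, himT⟩
  exact (IsBigO.of_bound 1 hle).trans (hC.add hI')

/-- **Stub 1 alone implies the Density Hypothesis** `N(σ, T) ≪ T^{2(1−σ)+ε}` (`1/2 ≤ σ ≤ 1`),
unconditionally: at `σ = 1/2` this is Ingham's theorem (`zeroDensity_ingham_holds`), and for `σ > 1/2`
the bound `O(T^ε)` of `countRe_isBigO_rpow_of_noRightInteriorBand` is stronger. -/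
theorem densityHypothesis_of_noRightInteriorBand
    (h1 : ∀ σ₀ : ℝ, 1 / 2 < σ₀ → σ₀ < 1 →
      ∃ ε : ℝ, 0 < ε ∧ {s : ℂ | riemannZeta s = 0 ∧ 0 < s.re ∧ s.re < 1 ∧ |s.re - σ₀| < ε}.Finite) :
    DensityHypothesis := by
  intro ε hε σ hσ hσ1
  rcases hσ.eq_or_lt with h | h
  · subst h
    have hI := zeroDensity_ingham_holds ε hε (1 / 2) le_rfl (by norm_num)
    have he : (3 / (2 - 1 / 2) * (1 - 1 / 2) + ε : ℝ) = 2 * (1 - 1 / 2) + ε := by norm_num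
    exact hI.congr_right fun T => by rw [he]
  · refine (countRe_isBigO_rpow_of_noRightInteriorBand h1 h hε).trans (IsBigO.of_bound 1 ?_)
    filter_upwards [eventually_ge_atTop (1 : ℝ)] with T hT
    rw [one_mul, Real.norm_of_nonneg (Real.rpow_nonneg (by linarith) _),
      Real.norm_of_nonneg (Real.rpow_nonneg (by linarith) _)]
    exact Real.rpow_le_rpow_of_exponent_le hT (by nlinarith)

/-- **Registered sub-goal `interiorImpliesDensityHypothesis`** of crux stmt-RiemannHypothesis-2063 (periphery of
line `interior-edge-split`, calibration): "no right-interior band" (stub 1 verbatim) implies the Density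
Hypothesis, unconditionally. -/
theorem interiorImpliesDensityHypothesis :
    (∀ σ₀ : ℝ, 1 / 2 < σ₀ → σ₀ < 1 →
      ∃ ε : ℝ, 0 < ε ∧ {s : ℂ | riemannZeta s = 0 ∧ 0 < s.re ∧ s.re < 1 ∧ |s.re - σ₀| < ε}.Finite) →
      Literature.NumberTheory.LFunctions.DensityHypothesis :=
  fun h1 => densityHypothesis_of_noRightInteriorBand h1

end Summit.RiemannHypothesis.RiemannHypothesis.Theorems.AsymptoticCriticalLine.InteriorEdgeSplit

end
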